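import Summits.BirchSwinnertonDyer.BirchSwinnertonDyer.Theorems.GenusKolyvaginAtTwoPowDvdShaCardAtTwoRTLocalEigenDualityAtKolyvaginPlace
import HarnessLib

/-!
# Route `GenusKolyvaginAtTwo`, crux L_T `PowDvdShaCardAtTwoRT` (stmt-BirchSwinnertonDyer-23242), LINE 18 stub KS, the DROPS' UP-swap —
# THE SHARP TRANSVERSE-SIDE UPPER BOUND AT THE OWN PRIME `λ₀` (P7b⁼, algebraic core and assembled form):
# `2^(a₀ + b₀ − (M+1)) • inv_v(y ∪ₑ x) = 0` for a free `ε`-eigen class `y` with `2^a₀ y ∈ 𝒯` and a transverse `ε`-eigen class `x` with `2^b₀ x = 0`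

Seat `bsd-line-gk2-p5` g24 (cell `bsd-f1-sign2`, SUPPLY lineage), `--supports stmt-BirchSwinnertonDyer-23242` (helper; closes nothing).
THEOREMS ONLY (no definition, no named fact, no `sorry`).  BSD is NOT proved by any of this; neither is the crux nor any stub.

WHY (LEAD gk2-p1 g18 ruling (R3), `…RTExactSwapCore` socket `hP7b`).  In the deep McCallum UP-swap the reciprocity sum for the pair
`(A = c_L(S ∪ ℓ′), c_aux)` has two surviving terms; the `λ′`-term has EXACT order `2^(e − M_r − 1)` (gk2-p3 g23's same-sign law
`addOrderOf_invWeilPairing_localization_eq_of_same_sign`, p724615), so the `λ₀`-term must be bounded ABOVE by `2^(e − w − 1)` SHARPLY —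
KRR's P7b (`KolyvaginRankRigidityAtTwoSwap*`, exponent `a₀ + b₀ − M`) is one bit short.  At `λ₀` the auxiliary class `y = loc c_aux` is FREE
(no local condition; `τ`-sign `ε`, `2^a₀ y` transverse) and `x = loc A` is TRANSVERSE of sign `ε` with `2^b₀ x = 0`.  MECHANISM: with a displayed
transverse complement `𝒯` of the Kummer condition `𝓛` (isotropic, `𝒯 ∩ 𝓛 = 0`, `σ`-stable) decompose `y = unr Q + t₀` (`t₀ ∈ 𝒯`): `t₀ ⊥ x`
(isotropy), `t Q = ε Q` (the `𝓛`- and `𝒯`-parts of `σy − εy = 0` vanish separately), `ord Q ≤ 2^a₀` (`2^a₀ unr Q ∈ 𝓛 ∩ 𝒯`), and the order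
of `x` MODULO `𝓛` is its order (`⟨x⟩ ∩ 𝓛 = 0`); gk2-p3's EXACT same-sign law on `(unr Q, x)` then gives order `2^(α + β − (M+1))` with
`α ≤ a₀`, `β ≤ b₀`.
* §1 (displayed structure of `…RTLocalEigenDuality` + displayed `𝒯`) `eigen_of_eigen_unr_add_transverse`,
  **`pow_smul_invWeilPairing_unr_add_eq_zero_of_same_sign_of_transverse`**, `pow_smul_invWeilPairing_eq_zero_of_eigen_of_transverse`.
* §2 **`pow_smul_invWeilPairing_eq_zero_of_same_sign_transverse_at`** — ASSEMBLED at a deep inert Kolyvagin place of the Heegner field on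
  `Δ < 0` (frame of p724615: `σ_* = conjActPlace`, regular frame, unramified parametrisation), `𝒯` displayed by its three properties and
  `y`'s decomposition `∃ z ∈ 𝓛_w, y − z ∈ 𝒯`.
HONEST FRAMING: the transfer to KRR's `localTatePairingZMod` / `weilDualIntertwining` currency (LEAD's typed `hP7b`) is gk2-p3's lane
(`X11b.LocBridge.localTatePairingZMod_map_weilDual`); this file is the invariant-pairing core.  Closes nothing.

References: [McCallumLMS1991] §4 Prop. 4.4, §5 Lemma 5.3 and (13); [Kolyvagin1991MathAnn] Thm. 2.1; [MilneADT2006] I Cor. 2.3;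
[Howard2004HeegnerKolyvagin] Lemma 1.5.3.
-/

set_option autoImplicit false

noncomputable section

open scoped Classical

open CategoryTheory Field NumberField IsDedekindDomain Function WeierstrassCurve
open Literature.NumberTheory.EllipticCurves
open Literature.NumberTheory.GaloisRepresentations
open Literature.NumberTheory.GaloisCohomology
open Literature.NumberTheory.Automorphic
open Summit.BirchSwinnertonDyer.Rank1Residual.X11b.KummerPT
open Summit.BirchSwinnertonDyer.Rank1Residual.X11b.FiniteDuality
open Summit.BirchSwinnertonDyer.Rank1Residual.X11b.Relaxation
open Summit.BirchSwinnertonDyer.Rank1Residual.JET.GlobalDuality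
open scoped ContRepresentation

-- the Theorems namespace of this sub repeats the summit name by design (D-0017 nested layout)
set_option linter.dupNamespace false

namespace Summit.BirchSwinnertonDyer.BirchSwinnertonDyer.Theorems.GenusExact.PlusDescent

/-! ## §1 The algebraic core over the displayed `τ`-structure and a displayed transverse complement -/

section Structure

variable {K : Type} [Field K] [NumberField K] (W : WeierstrassCurve K) [W.IsElliptic] (M : ℕ)
variable (e : W.geomTorsion ((2 ^ M : ℕ) : ℤ) → W.geomTorsion ((2 ^ M : ℕ) : ℤ) → AlgebraicClosure K)
  (hμ : ∀ S T, e S T ^ (2 ^ M) = 1)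
  (hadd₁ : ∀ S₁ S₂ T, e (S₁ + S₂) T = e S₁ T * e S₂ T)
  (hadd₂ : ∀ S T₁ T₂, e S (T₁ + T₂) = e S T₁ * e S T₂)
  (hgal : ∀ (γ : absoluteGaloisGroup K) (S T : W.geomTorsion ((2 ^ M : ℕ) : ℤ)), γ • e S T = e (γ • S) (γ • T))
  (halt : ∀ T, e T T = 1) (hnondeg : ∀ T, (∀ S, e S T = 1) → T = 0)
  (v : HeightOneSpectrum (𝓞 K)) (inv : LocalInvariants K (2 ^ M)) (hinv : Injective (inv (Sum.inr v)))

variable {T : Type*} [AddCommGroup T] (t : T →+ T) (ht : ∀ Q, t (t Q) = Q)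
  (σ : galoisCohomology ((W.torsionGaloisModule ((2 ^ M : ℕ) : ℤ)).toLocal (Sum.inr v)) 1 →+
    galoisCohomology ((W.torsionGaloisModule ((2 ^ M : ℕ) : ℤ)).toLocal (Sum.inr v)) 1)
  (hσ : ∀ X, σ (σ X) = X)
  (hσb : ∀ X Y, invWeilPairing W (2 ^ M) e hμ hadd₁ hadd₂ hgal inv (Sum.inr v) (σ X) (σ Y) =
    invWeilPairing W (2 ^ M) e hμ hadd₁ hadd₂ hgal inv (Sum.inr v) X Y)
  (unr : T →+ galoisCohomology ((W.torsionGaloisModule ((2 ^ M : ℕ) : ℤ)).toLocal (Sum.inr v)) 1)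
  (hunr : ∀ Q, unr (t Q) = σ (unr Q))
  (hunrL : ∀ Q, unr Q ∈ W.kummerSelmerStructure ((2 ^ M : ℕ) : ℤ) (Sum.inr v))
  (hLunr : ∀ Y ∈ W.kummerSelmerStructure ((2 ^ M : ℕ) : ℤ) (Sum.inr v), ∃ Q, unr Q = Y)
  (hunr0 : Injective unr)
  (P₁ : T)
  (hspan : ∀ Q : T, ∃ a b : ℤ, Q = a • P₁ + b • t P₁)
  (hfree : ∀ a b : ℤ, a • P₁ + b • t P₁ = 0 → (2 ^ M : ℤ) ∣ a ∧ (2 ^ M : ℤ) ∣ b)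
  (htor : (2 ^ M : ℤ) • P₁ = 0)
  (𝒯 : AddSubgroup (galoisCohomology ((W.torsionGaloisModule ((2 ^ M : ℕ) : ℤ)).toLocal (Sum.inr v)) 1))
  (h𝒯L : ∀ a ∈ 𝒯, a ∈ W.kummerSelmerStructure ((2 ^ M : ℕ) : ℤ) (Sum.inr v) → a = 0)

omit [W.IsElliptic] in
include hunr hunrL hunr0 h𝒯L in
/-- **The `𝓛`-part of an `ε`-eigenclass is `ε`-eigen**: if `σ(unr Q + t₀) = ε (unr Q + t₀)` with `t₀` in a `σ`-stable subgroup `𝒯`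
meeting `𝓛 = unr(T)` trivially, then `t Q = ε Q` (the `𝓛`- and `𝒯`-components of `σy − εy = 0` vanish separately). [folklore] -/
theorem eigen_of_eigen_unr_add_transverse (h𝒯σ : ∀ a ∈ 𝒯, σ a ∈ 𝒯) {Q : T}
    {t₀ : galoisCohomology ((W.torsionGaloisModule ((2 ^ M : ℕ) : ℤ)).toLocal (Sum.inr v)) 1} (ht₀ : t₀ ∈ 𝒯) {ε : ℤ}
    (hy : σ (unr Q + t₀) = ε • (unr Q + t₀)) : t Q = ε • Q := by
  have h1 : unr (t Q - ε • Q) = ε • t₀ - σ t₀ := by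
    rw [map_add, smul_add] at hy
    rw [map_sub, map_zsmul, hunr, sub_eq_sub_iff_add_eq_add, hy, add_comm]
  have h2 : unr (t Q - ε • Q) ∈ 𝒯 := by
    rw [h1]
    exact 𝒯.sub_mem (𝒯.zsmul_mem ht₀ ε) (h𝒯σ t₀ ht₀)
  have h3 : unr (t Q - ε • Q) = 0 := h𝒯L _ h2 (hunrL _)
  exact sub_eq_zero.mp (hunr0 (h3.trans (map_zero unr).symm))

include halt hnondeg hinv ht hσ hσb hunr hunrL hLunr hunr0 hspan hfree htor h𝒯L in
/-- **THE SHARP TRANSVERSE-SIDE UPPER BOUND (same sign), algebraic core.**  Displayed structure of `…RTLocalEigenDuality` plus a displayed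
subgroup `𝒯` ISOTROPIC for `inv_v(· ∪ₑ ·)` and meeting `𝓛` trivially.  For `y = unr Q + t₀` (`t₀ ∈ 𝒯`) with `2^a₀ y ∈ 𝒯`, and `x ∈ 𝒯` with
`2^b₀ x = 0`, of the SAME sign (`tQ = εQ`, `σx = εx`):  **`2^(a₀ + b₀ − (M+1)) • inv_v(y ∪ₑ x) = 0`**.  (`t₀ ⊥ x`; `ord Q = 2^α`, `α ≤ a₀`, since
`2^a₀ unr Q ∈ 𝓛 ∩ 𝒯 = 0`; the order of `x` modulo `𝓛` is `ord x = 2^β`, `β ≤ b₀`; the exact law gives `2^(α+β−(M+1))`.)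
[cite: McCallumLMS1991, §5 Lemma 5.3 and (13)] [cite: Kolyvagin1991MathAnn, Thm. 2.1] -/
theorem pow_smul_invWeilPairing_unr_add_eq_zero_of_same_sign_of_transverse (hM : M ≠ 0)
    (h𝒯iso : ∀ a ∈ 𝒯, ∀ a' ∈ 𝒯, invWeilPairing W (2 ^ M) e hμ hadd₁ hadd₂ hgal inv (Sum.inr v) a a' = 0)
    {Q : T} {t₀ x : galoisCohomology ((W.torsionGaloisModule ((2 ^ M : ℕ) : ℤ)).toLocal (Sum.inr v)) 1} (ht₀ : t₀ ∈ 𝒯) (hx : x ∈ 𝒯)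
    (hQX : (t Q = Q ∧ σ x = x) ∨ (t Q = -Q ∧ σ x = -x)) {a₀ b₀ : ℕ} (ha : (2 ^ a₀) • (unr Q + t₀) ∈ 𝒯) (hb : (2 ^ b₀) • x = 0) :
    (2 ^ (a₀ + b₀ - (M + 1))) • invWeilPairing W (2 ^ M) e hμ hadd₁ hadd₂ hgal inv (Sum.inr v) (unr Q + t₀) x = 0 := by
  -- `t₀ ⊥ x`
  have hsum : invWeilPairing W (2 ^ M) e hμ hadd₁ hadd₂ hgal inv (Sum.inr v) (unr Q + t₀) x =
      invWeilPairing W (2 ^ M) e hμ hadd₁ hadd₂ hgal inv (Sum.inr v) (unr Q) x := by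
    rw [map_add, AddMonoidHom.add_apply, h𝒯iso t₀ ht₀ x hx, add_zero]
  rw [hsum]
  -- the order of `Q`: `2^α` with `α ≤ a₀`
  have h2M : (2 ^ M) • unr Q = 0 := nsmul_galoisCohomology_toLocal_eq_zero W (2 ^ M) _ _
  have hQM : (2 ^ M) • Q = 0 := hunr0 (by rw [map_nsmul, h2M, map_zero])
  obtain ⟨α, -, hα⟩ := (Nat.dvd_prime_pow Nat.prime_two).mp (addOrderOf_dvd_of_nsmul_eq_zero hQM)
  have hαa : α ≤ a₀ := by
    have h1 : (2 ^ a₀) • unr Q ∈ 𝒯 := by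
      have h := 𝒯.sub_mem ha (𝒯.nsmul_mem ht₀ (2 ^ a₀))
      rwa [smul_add, add_sub_cancel_right] at h
    have h2 : (2 ^ a₀) • unr Q = 0 :=
      h𝒯L _ h1 ((W.kummerSelmerStructure ((2 ^ M : ℕ) : ℤ) (Sum.inr v)).nsmul_mem (hunrL Q) _)
    have h3 : (2 ^ a₀) • Q = 0 := hunr0 (by rw [map_nsmul, h2, map_zero])
    have h4 : 2 ^ α ∣ 2 ^ a₀ := hα ▸ addOrderOf_dvd_of_nsmul_eq_zero h3
    exact (Nat.pow_dvd_pow_iff_le_right one_lt_two).mp h4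
  -- the order of `x`: `2^β` with `β ≤ b₀`, read modulo `𝓛`
  have hxM : (2 ^ M) • x = 0 := nsmul_galoisCohomology_toLocal_eq_zero W (2 ^ M) _ _
  obtain ⟨β, -, hβ⟩ := (Nat.dvd_prime_pow Nat.prime_two).mp (addOrderOf_dvd_of_nsmul_eq_zero hxM)
  have hβb : β ≤ b₀ := by
    have h4 : 2 ^ β ∣ 2 ^ b₀ := hβ ▸ addOrderOf_dvd_of_nsmul_eq_zero hb
    exact (Nat.pow_dvd_pow_iff_le_right one_lt_two).mp h4
  have hβiff : ∀ j : ℕ, (2 ^ j) • x ∈ W.kummerSelmerStructure ((2 ^ M : ℕ) : ℤ) (Sum.inr v) ↔ β ≤ j := fun j ↦ by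
    constructor
    · intro hj
      have h0 : (2 ^ j) • x = 0 := h𝒯L _ (𝒯.nsmul_mem hx _) hj
      have h4 : 2 ^ β ∣ 2 ^ j := hβ ▸ addOrderOf_dvd_of_nsmul_eq_zero h0
      exact (Nat.pow_dvd_pow_iff_le_right one_lt_two).mp h4
    · intro hj
      have h0 : (2 ^ j) • x = 0 := by
        obtain ⟨c, rfl⟩ := Nat.exists_eq_add_of_le hj
        rw [pow_add, mul_nsmul, ← hβ, addOrderOf_nsmul_eq_zero, nsmul_zero]
      rw [h0]
      exact (W.kummerSelmerStructure ((2 ^ M : ℕ) : ℤ) (Sum.inr v)).zero_mem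
  -- the exact law
  have key := addOrderOf_invWeilPairing_unr_eq_of_same_sign W M e hμ hadd₁ hadd₂ hgal halt hnondeg v inv hinv t ht σ hσ hσb unr hunr hunrL
    hLunr P₁ hspan hfree htor hM hQX hα hβiff
  have hdvd : 2 ^ (α + β - (M + 1)) ∣ 2 ^ (a₀ + b₀ - (M + 1)) := pow_dvd_pow 2 (by omega)
  rw [← addOrderOf_dvd_iff_nsmul_eq_zero, key]
  exact hdvd

include halt hnondeg hinv ht hσ hσb hunr hunrL hLunr hunr0 hspan hfree htor h𝒯L in
/-- **P7b⁼, eigen form**: as above with the signs read from `σ`: `σ y = ε y` for `y = unr Q + t₀` and `σ x = ε x` (`ε = ±1`), `𝒯` moreover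
`σ`-stable. [cite: McCallumLMS1991, §5 Lemma 5.3 and (13)] [cite: Kolyvagin1991MathAnn, Thm. 2.1] -/
theorem pow_smul_invWeilPairing_eq_zero_of_eigen_of_transverse (hM : M ≠ 0)
    (h𝒯iso : ∀ a ∈ 𝒯, ∀ a' ∈ 𝒯, invWeilPairing W (2 ^ M) e hμ hadd₁ hadd₂ hgal inv (Sum.inr v) a a' = 0)
    (h𝒯σ : ∀ a ∈ 𝒯, σ a ∈ 𝒯)
    {Q : T} {t₀ x : galoisCohomology ((W.torsionGaloisModule ((2 ^ M : ℕ) : ℤ)).toLocal (Sum.inr v)) 1} (ht₀ : t₀ ∈ 𝒯) (hx : x ∈ 𝒯)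
    {ε : ℤ} (hε : ε = 1 ∨ ε = -1) (hy : σ (unr Q + t₀) = ε • (unr Q + t₀)) (hxσ : σ x = ε • x)
    {a₀ b₀ : ℕ} (ha : (2 ^ a₀) • (unr Q + t₀) ∈ 𝒯) (hb : (2 ^ b₀) • x = 0) :
    (2 ^ (a₀ + b₀ - (M + 1))) • invWeilPairing W (2 ^ M) e hμ hadd₁ hadd₂ hgal inv (Sum.inr v) (unr Q + t₀) x = 0 := by
  have htQ : t Q = ε • Q := eigen_of_eigen_unr_add_transverse W M v σ unr hunr hunrL hunr0 𝒯 h𝒯L (t := t) h𝒯σ ht₀ hy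
  have hQX : (t Q = Q ∧ σ x = x) ∨ (t Q = -Q ∧ σ x = -x) := by
    rcases hε with rfl | rfl
    · left; rw [one_zsmul] at htQ hxσ; exact ⟨htQ, hxσ⟩
    · right; rw [neg_one_zsmul] at htQ hxσ; exact ⟨htQ, hxσ⟩
  exact pow_smul_invWeilPairing_unr_add_eq_zero_of_same_sign_of_transverse W M e hμ hadd₁ hadd₂ hgal halt hnondeg v inv hinv t ht σ hσ hσb
    unr hunr hunrL hLunr hunr0 P₁ hspan hfree htor 𝒯 h𝒯L hM h𝒯iso ht₀ hx hQX ha hb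

end Structure

/-! ## §2 Assembled at a deep inert Kolyvagin place of the Heegner field -/

variable (W : WeierstrassCurve ℚ) (K : Type) [Field K] [NumberField K] [W.IsElliptic] [W.IsGloballyMinimal]

/-- **P7b⁼ AT A DEEP INERT KOLYVAGIN PLACE (assembled).**  Frame of p724615 (`K` imaginary quadratic, `τ ≠ 1`, `τ² = 1`, `Δ < 0`, `ℓ`
Zhang–Kolyvagin at `2` with `1 ≤ M ≤ M(ℓ)` and `FrobEqFrobInfty W K (2^M) ℓ`, `w ∋ ℓ`, `τ • w = w`, Weil datum with `hte`, `inv` injective at `w`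
and `IsConjCompatible τ`), plus a displayed subgroup `𝒯 ≤ H¹(K_w, E[2^M])` — isotropic for `inv_w(· ∪ₑ ·)`, meeting the Kummer condition `𝓛_w`
trivially, `σ_*`-stable (the transverse condition at the own prime).  For local classes `y, x` with `σ_* y = ε y`, `σ_* x = ε x` (`ε = ±1`),
`y ≡ 𝓛_w (mod 𝒯)` (`∃ z ∈ 𝓛_w, y − z ∈ 𝒯`), `2^a₀ y ∈ 𝒯`, `x ∈ 𝒯`, `2^b₀ x = 0`:  **`2^(a₀ + b₀ − (M+1)) • inv_w(y ∪ₑ x) = 0`** — one bit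
sharper than KRR's P7b. [cite: McCallumLMS1991, §5 Lemma 5.3 and (13)] [cite: Kolyvagin1991MathAnn, Thm. 2.1] [cite: GrossLMS1991, §3 (3.2)] -/
theorem pow_smul_invWeilPairing_eq_zero_of_same_sign_transverse_at (hK : IsImaginaryQuadratic K) (hΔ : W.Δ < 0)
    {M ℓ : ℕ} (hM : 1 ≤ M)
    (hℓ : Zhang2014.IsKolyvaginPrime (W.conductorNorm ℤ) W K 2 ℓ) (hk : M ≤ Zhang2014.kolyvaginIndex W 2 ℓ)
    (hF : FrobEqFrobInfty W K (2 ^ M) ℓ) (w : HeightOneSpectrum (𝓞 K)) (hw : (ℓ : 𝓞 K) ∈ w.asIdeal)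
    {τ : K ≃ₐ[ℚ] K} (hτ1 : τ ≠ 1) (hττ : τ * τ = 1) (hfix : τ • w = w)
    (e : (W.baseChange K).geomTorsion ((2 ^ M : ℕ) : ℤ) → (W.baseChange K).geomTorsion ((2 ^ M : ℕ) : ℤ) → AlgebraicClosure K)
    (hμ : ∀ S T, e S T ^ (2 ^ M) = 1)
    (hadd₁ : ∀ S₁ S₂ T, e (S₁ + S₂) T = e S₁ T * e S₂ T)
    (hadd₂ : ∀ S T₁ T₂, e S (T₁ + T₂) = e S T₁ * e S T₂)
    (hgal : ∀ (γ : absoluteGaloisGroup K) (S T : (W.baseChange K).geomTorsion ((2 ^ M : ℕ) : ℤ)), γ • e S T = e (γ • S) (γ • T))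
    (halt : ∀ T, e T T = 1) (hnondeg : ∀ T, (∀ S, e S T = 1) → T = 0)
    (hte : ∀ S T, e ((isLiftOfAut_liftAutPlace τ hfix).torsionMap W ((2 ^ M : ℕ) : ℤ) S)
      ((isLiftOfAut_liftAutPlace τ hfix).torsionMap W ((2 ^ M : ℕ) : ℤ) T) = liftAutPlace τ hfix (e S T))
    (inv : LocalInvariants K (2 ^ M)) (hinj : Injective (inv (Sum.inr w))) (hinvc : inv.IsConjCompatible τ)
    (𝒯 : AddSubgroup (galoisCohomology (((W.baseChange K).torsionGaloisModule ((2 ^ M : ℕ) : ℤ)).toLocal (Sum.inr w : Place K)) 1))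
    (h𝒯iso : ∀ a ∈ 𝒯, ∀ a' ∈ 𝒯, invWeilPairing (W.baseChange K) (2 ^ M) e hμ hadd₁ hadd₂ hgal inv (Sum.inr w) a a' = 0)
    (h𝒯L : ∀ a ∈ 𝒯, a ∈ (W.baseChange K).kummerSelmerStructure ((2 ^ M : ℕ) : ℤ) (Sum.inr w) → a = 0)
    (h𝒯σ : ∀ a ∈ 𝒯, conjActPlace W τ ((2 ^ M : ℕ) : ℤ) hfix a ∈ 𝒯)
    {y x : galoisCohomology (((W.baseChange K).torsionGaloisModule ((2 ^ M : ℕ) : ℤ)).toLocal (Sum.inr w : Place K)) 1}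
    {ε : ℤ} (hε : ε = 1 ∨ ε = -1)
    (hy : conjActPlace W τ ((2 ^ M : ℕ) : ℤ) hfix y = ε • y) (hx : conjActPlace W τ ((2 ^ M : ℕ) : ℤ) hfix x = ε • x)
    (hyL : ∃ z ∈ (W.baseChange K).kummerSelmerStructure ((2 ^ M : ℕ) : ℤ) (Sum.inr w), y - z ∈ 𝒯) (hx𝒯 : x ∈ 𝒯)
    {a₀ b₀ : ℕ} (ha : (2 ^ a₀) • y ∈ 𝒯) (hb : (2 ^ b₀) • x = 0) :
    (2 ^ (a₀ + b₀ - (M + 1))) • invWeilPairing (W.baseChange K) (2 ^ M) e hμ hadd₁ hadd₂ hgal inv (Sum.inr w) y x = 0 := by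
  haveI : Fact (Nat.Prime 2) := ⟨Nat.prime_two⟩
  have hM0 : M ≠ 0 := by omega
  -- good reduction and `2 ∉ λ`
  obtain ⟨hgood, hpw⟩ := hasGoodReductionAt_of_zhangKolyvaginPrime W K hℓ w hw 1
  have hpw' : ((2 : ℕ) : 𝓞 K) ∉ w.asIdeal := by rwa [pow_one, Int.cast_natCast] at hpw
  -- the `τ`-structure: `σ` involutive and preserving the pairing
  have hσ : ∀ X, conjActPlace W τ ((2 ^ M : ℕ) : ℤ) hfix (conjActPlace W τ ((2 ^ M : ℕ) : ℤ) hfix X) = X :=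
    fun X ↦ conjActPlace_conjActPlace_self W τ (2 ^ M) hττ hfix X
  have hσb := invWeilPairing_conjActPlace_self W τ (2 ^ M) e hμ hadd₁ hadd₂ hgal hfix hte inv hinvc
  -- the unramified parametrisation and the regular frame
  obtain ⟨unr, hunr0, hunrL, hLunr, hunr⟩ :=
    exists_unramified_parametrization_kummer W K hK (p := 2) (k := M) hℓ hk w hw hpw' hgood τ hfix
  obtain ⟨Q₀, htor, hspan, hfree, ht⟩ := exists_regular_frame_liftAutPlace W K hK hΔ hM hℓ hk hF w hw hτ1 hfix
  -- decompose `y = unr Q + t₀`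
  obtain ⟨z, hz, hyz⟩ := hyL
  obtain ⟨Q, hQ⟩ := hLunr z hz
  have hyd : y = unr Q + (y - z) := by rw [hQ, add_sub_cancel]
  rw [hyd] at hy ha ⊢
  exact pow_smul_invWeilPairing_eq_zero_of_eigen_of_transverse (W.baseChange K) M e hμ hadd₁ hadd₂ hgal halt hnondeg w inv hinj _ ht _ hσ
    hσb unr hunr hunrL hLunr hunr0 Q₀ hspan hfree htor 𝒯 h𝒯L hM0 h𝒯iso h𝒯σ hyz hx𝒯 hε hy hx ha hb

end Summit.BirchSwinnertonDyer.BirchSwinnertonDyer.Theorems.GenusExact.PlusDescent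

end
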